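import Literature.Analysis.FluidPDE.TsaiProfileEndgame
import HarnessLib

/-!
# Route CorkscrewDynamo · crux `CorkscrewProfile` (stmt-NavierStokesRegularity-11282) — tool stub T5: `DΠ_A(y) = 0` and `DU(y)` symmetric force `ΔU(y) = 0` for a rotated Leray profile

Tool stub `stub_rotatedLaplacianZero` of line `registered` (skeleton v10, lead c5): the endgame step
of the Liouville theorem for the ROTATED Leray profile system
`−νΔU + aU + aDU[y] + (A U − DU[A y]) + DU[U] + ∇P = 0` on a finite-dimensional real inner product
space `E`, `A` skew (on `ℝ³`, `A = α·(e₃ × ·)`). At a point `y` where the rotation-gauged head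
pressure `Π_A(z) = Π(z) − ⟪A z, U z⟫` (`Π = ½|U|² + P + a y·U`, `headPressure`) has vanishing
gradient and the velocity gradient is symmetric (`spin U y = DU − DUᵀ = 0`), pairing the system
with `ΔU(y)` and subtracting `DΠ_A(y)[ΔU(y)] = 0` leaves `−ν|ΔU(y)|² = 0` (the case `A = 0` is
Tsai 1998, p. 48, `IsLerayProfile.laplacian_eq_zero_of_headPressure_const_of_contDiff`).
-/

noncomputable section

open MeasureTheory Set Function Filter Topology InnerProductSpace Metric
open Literature.Analysis.FluidPDE
open scoped RealInnerProductSpace Laplacian ContDiff NNReal ENNReal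

namespace Summit.NavierStokesRegularity.NavierStokesRegularity.Theorems.CorkscrewProfile.Birth

set_option linter.dupNamespace false

variable {E : Type*} [NormedAddCommGroup E] [InnerProductSpace ℝ E] [FiniteDimensional ℝ E]

/-- **Endgame step for the rotated Leray profile system.** If `(U, P)` (`U ∈ C³`, `P ∈ C²`,
`ν ≠ 0`) solves `−νΔU + aU + aDU[y] + (A U − DU[A y]) + DU[U] + ∇P = 0` with `A` skew-adjoint,
then at every point `y` where the gauged head pressure `z ↦ Π(z) − ⟪A z, U z⟫` has zero derivative
and `spin U y = DU(y) − DU(y)ᵀ = 0`, the velocity is harmonic: `ΔU(y) = 0`. Indeed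
`DΠ_A(y) w = ⟪U, DU w⟫ + DP w + a(⟪w, U⟫ + ⟪y, DU w⟫) − ⟪A y, DU w⟫ − ⟪A w, U⟫`; with `DU`
symmetric and `A` skew this is `⟪DU U + ∇P + aU + aDU y − DU (A y) + A U, w⟫`, so the system at
`w = ΔU(y)` reads `ν |ΔU(y)|² = 0` (cf. Tsai 1998, p. 48, for `A = 0`). [cite: Tsai1998, p. 48 (proofs of Theorems 1 and 2)] -/
theorem stub_rotatedLaplacianZero {ν a : ℝ} {U : E → E} {P : E → ℝ} (A : E →L[ℝ] E)
    (hA : ∀ v w : E, ⟪A v, w⟫ = -⟪v, A w⟫) (hν : ν ≠ 0)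
    (hU3 : ContDiff ℝ 3 U) (hP2 : ContDiff ℝ 2 P)
    (heq : ∀ y, -(ν • (Δ U) y) + a • U y + a • fderiv ℝ U y y + (A (U y) - fderiv ℝ U y (A y)) +
      convect U U y + gradient P y = 0)
    {y : E} (hD0 : ∀ w, fderiv ℝ (fun z => headPressure a U P z - ⟪A z, U z⟫) y w = 0)
    (hspin : spin U y = 0) : (Δ U) y = 0 := by
  haveI : CompleteSpace E := FiniteDimensional.complete ℝ E
  have hU1 : ContDiff ℝ 1 U := hU3.of_le (by norm_num)
  have hP1 : ContDiff ℝ 1 P := hP2.of_le (by norm_num)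
  have hUd : Differentiable ℝ U := hU1.differentiable one_ne_zero
  have hPd : Differentiable ℝ P := hP1.differentiable one_ne_zero
  -- the velocity gradient is symmetric: `DU = DUᵀ`
  have hadj : ContinuousLinearMap.adjoint (fderiv ℝ U y) = fderiv ℝ U y := by
    unfold spin at hspin
    exact (sub_eq_zero.1 hspin).symm
  have hsymm : ∀ v w, ⟪fderiv ℝ U y v, w⟫ = ⟪v, fderiv ℝ U y w⟫ := fun v w => by
    rw [← ContinuousLinearMap.adjoint_inner_right (fderiv ℝ U y) v w, hadj]
  -- the gradient of the gauged head pressure vanishes at `y`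
  have hHd : Differentiable ℝ (headPressure a U P) :=
    (contDiff_headPressure (a := a) hU1 hP1).differentiable one_ne_zero
  have hAU : DifferentiableAt ℝ (fun z => ⟪A z, U z⟫) y := A.differentiableAt.inner ℝ (hUd y)
  have hDw : ∀ w, ⟪U y, fderiv ℝ U y w⟫ + fderiv ℝ P y w + a * (⟪w, U y⟫ + ⟪y, fderiv ℝ U y w⟫) -
      (⟪A y, fderiv ℝ U y w⟫ + ⟪A w, U y⟫) = 0 := fun w => by
    have h := hD0 w
    rw [fderiv_fun_sub (hHd y) hAU, _root_.sub_apply,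
      fderiv_headPressure_apply hUd hPd y w, fderiv_inner_apply ℝ A.differentiableAt (hUd y),
      A.fderiv] at h
    exact h
  -- pair the profile system with `w = ΔU(y)`
  have hEw : ⟪-(ν • (Δ U) y) + a • U y + a • fderiv ℝ U y y + (A (U y) - fderiv ℝ U y (A y)) +
      convect U U y + gradient P y, (Δ U) y⟫ = 0 := by
    rw [heq y, inner_zero_left]
  simp only [inner_add_left, inner_sub_left, inner_neg_left, real_inner_smul_left, convect_apply,
    gradient, InnerProductSpace.toDual_symm_apply] at hEw
  set L : E := (Δ U : E → E) y with hL
  have h1 := hsymm (U y) L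
  have h2 := hsymm y L
  have h4 := hsymm (A y) L
  have h3 := hDw L
  rw [real_inner_comm (U y) L] at h3
  have h5 : ⟪A L, U y⟫ = -⟪A (U y), L⟫ := by rw [hA, real_inner_comm]
  have key : ν * ⟪L, L⟫ = 0 := by
    linear_combination (-1 : ℝ) * hEw + h3 + h1 + a * h2 - h4 + h5
  rcases mul_eq_zero.1 key with hν0 | hww
  · exact absurd hν0 hν
  · exact inner_self_eq_zero.1 hww

end Summit.NavierStokesRegularity.NavierStokesRegularity.Theorems.CorkscrewProfile.Birth
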